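import Summits.NavierStokesRegularity.NavierStokesRegularity.Theorems.TypeICertificateLadderTargetDepletedEnstrophyDecay
import Summits.NavierStokesRegularity.NavierStokesRegularity.Theorems.TypeICertificateLadderRungReynoldsOne
import HarnessLib

/-!
# Crux `Target` = `TypeICertificateLadder.NoTypeIBlowup` (stmt-NavierStokesRegularity-1217), line
# `depletion-ladder`: stub S2 `stub_rung_of_depletion` — a depletion constant closes every rung below
# its reciprocal

`--supports stmt-NavierStokesRegularity-1217`. Line `depletion-ladder` (crux-strategist
`cstrat-stmt-NavierStokesRegularity-1217-p1`, 2026-08-17; skeleton of record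
`Cruxes/Target/Lines/depletion_ladder.lean`, sha f7213e70…; card `Cruxes/Target/Lines/depletion-ladder.md`).
Registered stub S2, VERBATIM after unfolding the two line-local abbreviations
`DepletionLadder.StretchingDepletion κ` and `DepletionLadder.Rung C` of the skeleton:

  `stub_rung_of_depletion : ∀ κ > 0, StretchingDepletion κ → ∀ C > 0, κ·C < 1 → Rung C`

(`rung_of_stretchingDepletion` below; in the skeleton, `stub_rung_of_depletion` is closed by
`fun κ hκ h C hC hκC => Theorems.rung_of_stretchingDepletion κ hκ h C hC hκC`, the two `def`s
unfolding definitionally).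

**Content.** `StretchingDepletion κ`: for every `C²` divergence-free `u : ℝ³ → ℝ³` bounded by `M`,
with `ω = curl u`, `ω, ∇ω ∈ L²` and integrable stretching density,
`|∫ ⟪ω, Du ω⟫| ≤ κ · M · ‖ω‖₂ · ‖∇ω‖₂` (Cauchy–Schwarz gives `κ = 1`; the line conjectures
`κ < 1/2`, numerics `κ̂ ≈ 0.144`, kit j021500). `Rung C` (= the ladder's `X_C`): a classical
solution of the unforced Navier–Stokes system on `ℝ³ × [0,T)`, Leray–Hopf from its rapidly decaying
datum, with eventual dimensionless rate `√(T−t)‖u(t,x)‖ ≤ C√ν`, extends smoothly past `T`.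

**Proof** (the line card's S2 recipe, on rung one's infrastructure): the depleted enstrophy slice
inequality `d/dt‖ω‖₂² ≤ (κ²‖u‖²_∞/(2ν))‖ω‖₂²` (`DepletionLadder.depleted_enstrophy_slice`: vorticity
equation, transport `0`, viscosity `−ν‖∇ω‖²`, stretching `≤ κM‖ω‖‖∇ω‖`, Young), Grönwall on the
Tao-class sub-slabs (`DepletionLadder.lintegral_curl_sq_le_exp_depleted`, `RungReynoldsOne.stub_taoCover`),
the rate `‖u(t)‖²_∞ ≤ C²ν/(T−t)` ⇒ `‖u(t)‖₂² + ‖∇u(t)‖₂² ≤ K(T−t)^{−κ²C²/2}`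
(`DepletionLadder.energy_add_enstrophy_le_rpow_of_rate`), against the `H¹` blow-up rate at a time with
no classical extension `cν³ ≤ (‖u‖₂² + ‖∇u‖₂²)²(T−t)` (`RungReynoldsOne.stub_h1BlowupRate`): since
`κC < 1 ⇔ 2·(κ²C²/2) < 1`, `cν³ ≤ K²(T−t)^{1−κ²C²} → 0` — contradiction
(`hasSmoothExtensionPast_of_powerRate`, the exponent-generic form of
`rungReynoldsOne_of_decay_of_rate`).

**Logical position.** With `κ = 1` (Cauchy–Schwarz) this is the enstrophy rung `C < 1`
(`RungReynoldsOneNegative.budgetCloses_two_iff`); any certified `κ < (√6+√2)/4 ≈ 0.966` in S1's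
inequality now yields rungs `X_C`, `√6 − √2 < C < 1/κ`, ABOVE the kernel-checked ceiling of the whole
`L^q`-vorticity budget family (`RungReynoldsOneNegative.lt_ceiling_of_budgetCloses`). The line's other
stubs are untouched: S1 `stub_depletionBelowHalf` (the sharp inequality, open) and S3
`stub_descentToRungTwo` (= the crux above rung two, open problem).

WHAT THIS IS NOT: not a proof of a rung — a CONDITIONAL rung (hypothesis = the line's depletion
inequality); nothing about Type II; the energy class is load-bearing through `stub_h1BlowupRate`.

References: Leray 1934 §§19–20; P. G. Lemarié-Rieusset, *The Navier–Stokes Problem in the 21st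
Century* (2016), Thm. 11.2; J. C. Robinson, J. L. Rodrigo, W. Sadowski (2016), Lemma 6.11 /
Lemma 8.16; T. Tao, arXiv:1108.1165, Thm. 5.4 / Cor. 11.1. [folklore]
-/

noncomputable section

open Set Filter Topology MeasureTheory
open scoped RealInnerProductSpace ENNReal NNReal Laplacian ContDiff
open Literature.Analysis.FluidPDE

namespace Summit.NavierStokesRegularity.NavierStokesRegularity.Theorems

-- the problem directory repeats the summit name (`NavierStokesRegularity/NavierStokesRegularity`)
set_option linter.dupNamespace false

open Summit.NavierStokesRegularity.NavierStokesRegularity.Theorems.RungReynoldsOne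
open Summit.NavierStokesRegularity.NavierStokesRegularity.Theorems.DepletionLadder

/-- **Subcritical `H¹` growth plus the `H¹` blow-up rate give a classical extension** (the
exponent-generic form of `rungReynoldsOne_of_decay_of_rate`): if a classical Leray–Hopf
rapidly-decaying-datum solution on `ℝ³ × [0,T)` has `‖u(t)‖₂² + ‖∇u(t)‖₂² ≤ K(T−t)^{−γ}` on some
`[t₀, T)` with `γ < 1/2`, it extends smoothly past `T`: otherwise `RungReynoldsOne.stub_h1BlowupRate`
gives `cν³ ≤ (‖u(t)‖₂² + ‖∇u(t)‖₂²)²(T−t) ≤ K²(T−t)^{1−2γ} → 0`. [folklore] -/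
theorem hasSmoothExtensionPast_of_powerRate {ν T γ K : ℝ} (hν : 0 < ν) (hT : 0 < T) (hγ : γ < 1 / 2)
    {u : ℝ → EuclideanSpace ℝ (Fin 3) → EuclideanSpace ℝ (Fin 3)}
    {p : ℝ → EuclideanSpace ℝ (Fin 3) → ℝ}
    (hsol : IsClassicalNSSolutionOn (Ico 0 T) ν 0 u p) (hLH : IsLerayHopfOn T ν 0 (u 0) u)
    (hdec : HasRapidSpatialDecay (u 0))
    (hK : ∃ t₀ ∈ Ico 0 T, ∀ t ∈ Ico t₀ T,
      (∫⁻ x, ‖u t x‖ₑ ^ 2) + ∫⁻ x, ENNReal.ofReal (frobeniusNormSq (fderiv ℝ (u t) x)) ≤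
        ENNReal.ofReal (K * (T - t) ^ (-γ))) :
    HasSmoothExtensionPast ν 0 u T := by
  by_contra hext
  obtain ⟨t₀, ht₀, hKt⟩ := hK
  obtain ⟨c, hc, hlow⟩ := stub_h1BlowupRate
  have hlow' := hlow hν hT hsol hLH hdec hext
  have hcν : 0 < c * ν ^ 3 := mul_pos hc (pow_pos hν 3)
  have hsmall : ∀ᶠ t in 𝓝[<] T, K ^ 2 * (T - t) ^ (1 - 2 * γ) < c * ν ^ 3 :=
    (tendsto_order.1 (rungReynoldsOne_tendsto_sq_mul_rpow_sub (T := T) (K := K) hγ)).2 _ hcν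
  have hIco : ∀ᶠ t in 𝓝[<] T, t ∈ Ico t₀ T := Ico_mem_nhdsLT ht₀.2
  obtain ⟨t, ht, hsmallt⟩ := (hIco.and hsmall).exists
  have htT : t ∈ Ico 0 T := ⟨ht₀.1.trans ht.1, ht.2⟩
  have hTt : 0 < T - t := sub_pos.2 ht.2
  have hup := hKt t ht
  have hlo := hlow' t htT
  have hnn : 0 ≤ max K 0 * (T - t) ^ (-γ) :=
    mul_nonneg (le_max_right _ _) (Real.rpow_nonneg hTt.le _)
  have hup' : (∫⁻ x, ‖u t x‖ₑ ^ 2) + ∫⁻ x, ENNReal.ofReal (frobeniusNormSq (fderiv ℝ (u t) x)) ≤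
      ENNReal.ofReal (max K 0 * (T - t) ^ (-γ)) := by
    refine hup.trans (ENNReal.ofReal_le_ofReal ?_)
    exact mul_le_mul_of_nonneg_right (le_max_left _ _) (Real.rpow_nonneg hTt.le _)
  have hchain : ENNReal.ofReal (c * ν ^ 3) ≤
      ENNReal.ofReal ((max K 0) ^ 2 * (T - t) ^ (1 - 2 * γ)) := by
    calc ENNReal.ofReal (c * ν ^ 3)
        ≤ ((∫⁻ x, ‖u t x‖ₑ ^ 2) + ∫⁻ x, ENNReal.ofReal (frobeniusNormSq (fderiv ℝ (u t) x))) ^ 2 *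
            ENNReal.ofReal (T - t) := hlo
      _ ≤ (ENNReal.ofReal (max K 0 * (T - t) ^ (-γ))) ^ 2 * ENNReal.ofReal (T - t) := by
          gcongr
      _ = ENNReal.ofReal ((max K 0 * (T - t) ^ (-γ)) ^ 2 * (T - t)) := by
          rw [ENNReal.ofReal_mul (sq_nonneg _), ENNReal.ofReal_pow hnn]
      _ = ENNReal.ofReal ((max K 0) ^ 2 * (T - t) ^ (1 - 2 * γ)) := by
          rw [rungReynoldsOne_sq_mul_rpow_neg_mul hTt]
  have hnn' : 0 ≤ (max K 0) ^ 2 * (T - t) ^ (1 - 2 * γ) :=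
    mul_nonneg (sq_nonneg _) (Real.rpow_nonneg hTt.le _)
  have h1 := (ENNReal.ofReal_le_ofReal_iff hnn').1 hchain
  have h2 : (max K 0) ^ 2 ≤ K ^ 2 := by
    rcases le_total K 0 with hK0 | hK0
    · rw [max_eq_right hK0]; simpa using sq_nonneg K
    · rw [max_eq_left hK0]
  have h3 : (max K 0) ^ 2 * (T - t) ^ (1 - 2 * γ) ≤ K ^ 2 * (T - t) ^ (1 - 2 * γ) :=
    mul_le_mul_of_nonneg_right h2 (Real.rpow_nonneg hTt.le _)
  linarith

/-- **S2 of the line `depletion-ladder` (stub `stub_rung_of_depletion`, VERBATIM after unfolding the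
line-local `StretchingDepletion` / `Rung`): a depletion constant closes every rung below its
reciprocal.** For every `κ > 0`: if every `C²` divergence-free `u : ℝ³ → ℝ³` bounded by `M`, with
`curl u, ∇ curl u ∈ L²` and integrable stretching density, satisfies
`|∫ ⟪curl u, Du (curl u)⟫| ≤ κ·M·‖curl u‖₂·‖∇ curl u‖₂`, then for every `C > 0` with `κC < 1`
every classical solution of the unforced Navier–Stokes system on `ℝ³ × [0,T)` (`ν, T > 0`),
Leray–Hopf from its rapidly decaying datum, whose dimensionless rate is eventually at most `C`,
`√(T−t)‖u(t,x)‖ ≤ C√ν`, extends smoothly past `T`. Proof: depleted enstrophy Grönwall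
`‖u(t)‖₂² + ‖∇u(t)‖₂² ≤ K(T−t)^{−κ²C²/2}` (`DepletionLadder.energy_add_enstrophy_le_rpow_of_rate`)
and `κ²C²/2 < 1/2` in `hasSmoothExtensionPast_of_powerRate`. [folklore] -/
theorem rung_of_stretchingDepletion :
    ∀ κ : ℝ, 0 < κ →
      (∀ (u : EuclideanSpace ℝ (Fin 3) → EuclideanSpace ℝ (Fin 3)) (M : ℝ), ContDiff ℝ 2 u →
        VectorCalculus.IsDivFree u → (∀ x, ‖u x‖ ≤ M) →
        Integrable (fun x => ‖curl u x‖ ^ 2) →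
        Integrable (fun x => frobeniusNormSq (fderiv ℝ (curl u) x)) →
        Integrable (fun x => ⟪curl u x, fderiv ℝ u x (curl u x)⟫) →
        |∫ x, ⟪curl u x, fderiv ℝ u x (curl u x)⟫| ≤
          κ * M * Real.sqrt (∫ x, ‖curl u x‖ ^ 2) *
            Real.sqrt (∫ x, frobeniusNormSq (fderiv ℝ (curl u) x))) →
      ∀ C : ℝ, 0 < C → κ * C < 1 →
        ∀ (ν T : ℝ), 0 < ν → 0 < T →
          ∀ (u : ℝ → EuclideanSpace ℝ (Fin 3) → EuclideanSpace ℝ (Fin 3))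
            (p : ℝ → EuclideanSpace ℝ (Fin 3) → ℝ),
            IsClassicalNSSolutionOn (Set.Ico 0 T) ν 0 u p → IsLerayHopfOn T ν 0 (u 0) u →
            HasRapidSpatialDecay (u 0) →
            (∀ᶠ t in 𝓝[<] T, ∀ x, Real.sqrt (T - t) * ‖u t x‖ ≤ C * Real.sqrt ν) →
            HasSmoothExtensionPast ν 0 u T := by
  intro κ hκ hdep C hC hκC ν T hν hT u p hsol hLH hdec hrate
  have hγ : κ ^ 2 * C ^ 2 / 2 < 1 / 2 := by
    have h0 : 0 < κ * C := mul_pos hκ hC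
    have h1 : (κ * C) ^ 2 < 1 := by nlinarith
    rw [mul_pow] at h1
    linarith
  obtain ⟨K, t₀, ht₀, hK⟩ := energy_add_enstrophy_le_rpow_of_rate hν hT hdep hsol hLH hdec hrate
  exact hasSmoothExtensionPast_of_powerRate hν hT hγ hsol hLH hdec ⟨t₀, ht₀, hK⟩

/-- **Rungs below the reciprocal of a depletion constant, non-strict in `κ`.** The same conclusion
with the hypothesis `κ ≥ 0` (a depletion inequality with `κ ≤ 0` forces the stretching integral to
vanish and is covered by raising `κ`): for every `C > 0` with `κ·C < 1`, rung `X_C` holds.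
Raise `κ` to `κ' = (1 + κC)/(2C) > κ ≥ 0` — the depletion inequality is monotone in its constant —
with `κ'C = (1 + κC)/2 < 1`, and apply `rung_of_stretchingDepletion`. [folklore] -/
theorem rung_of_stretchingDepletion_of_nonneg {κ : ℝ} (hκ : 0 ≤ κ)
    (hdep : ∀ (u : EuclideanSpace ℝ (Fin 3) → EuclideanSpace ℝ (Fin 3)) (M : ℝ), ContDiff ℝ 2 u →
      VectorCalculus.IsDivFree u → (∀ x, ‖u x‖ ≤ M) →
      Integrable (fun x => ‖curl u x‖ ^ 2) →
      Integrable (fun x => frobeniusNormSq (fderiv ℝ (curl u) x)) →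
      Integrable (fun x => ⟪curl u x, fderiv ℝ u x (curl u x)⟫) →
      |∫ x, ⟪curl u x, fderiv ℝ u x (curl u x)⟫| ≤
        κ * M * Real.sqrt (∫ x, ‖curl u x‖ ^ 2) *
          Real.sqrt (∫ x, frobeniusNormSq (fderiv ℝ (curl u) x)))
    {C : ℝ} (hC : 0 < C) (hκC : κ * C < 1) {ν T : ℝ} (hν : 0 < ν) (hT : 0 < T)
    {u : ℝ → EuclideanSpace ℝ (Fin 3) → EuclideanSpace ℝ (Fin 3)}
    {p : ℝ → EuclideanSpace ℝ (Fin 3) → ℝ}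
    (hsol : IsClassicalNSSolutionOn (Set.Ico 0 T) ν 0 u p) (hLH : IsLerayHopfOn T ν 0 (u 0) u)
    (hdec : HasRapidSpatialDecay (u 0))
    (hrate : ∀ᶠ t in 𝓝[<] T, ∀ x, Real.sqrt (T - t) * ‖u t x‖ ≤ C * Real.sqrt ν) :
    HasSmoothExtensionPast ν 0 u T := by
  set κ' : ℝ := (1 + κ * C) / (2 * C) with hκ'
  have hκ'pos : 0 < κ' := by rw [hκ']; positivity
  have hκ'C : κ' * C < 1 := by
    rw [hκ', div_mul_eq_mul_div, div_lt_one (by positivity)]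
    nlinarith
  have hκle : κ ≤ κ' := by
    rw [hκ', le_div_iff₀ (by positivity)]
    nlinarith
  refine rung_of_stretchingDepletion κ' hκ'pos (fun v M hv hdiv hM hi1 hi2 hi3 => ?_) C hC hκ'C ν T
    hν hT u p hsol hLH hdec hrate
  have hM0 : 0 ≤ M := (norm_nonneg (v 0)).trans (hM 0)
  refine (hdep v M hv hdiv hM hi1 hi2 hi3).trans ?_
  have hA : 0 ≤ Real.sqrt (∫ x, ‖curl v x‖ ^ 2) := Real.sqrt_nonneg _
  have hB : 0 ≤ Real.sqrt (∫ x, frobeniusNormSq (fderiv ℝ (curl v) x)) := Real.sqrt_nonneg _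
  have h1 : κ * M ≤ κ' * M := mul_le_mul_of_nonneg_right hκle hM0
  exact mul_le_mul_of_nonneg_right (mul_le_mul_of_nonneg_right h1 hA) hB

end Summit.NavierStokesRegularity.NavierStokesRegularity.Theorems

end
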